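import Literature.Combinatorics.SimpleGraph.LittleEarStructure
import Literature.Combinatorics.SimpleGraph.RemovableArc
import HarnessLib

/-!
# Minimal non-Pfaffian bipartite graphs: strong connectivity, degrees, removable arcs

Topic `Combinatorics/SimpleGraph`; theorems only. Consequences of the ear structure
(`exists_ear_structure`, `LittleEarStructure.lean`) for a deletion-minimal non-Pfaffian
`G ⊇ diagonal` (setting of `LittleTheoremReduction.lean`; digraph `D(G, M)` with arcs `IsArc G`,
`MatchingDigraph.lean`), i.e. the first structural steps of the analysis of a minimal non-Pfaffian
bipartite graph (Little 1975, §4; Seymour–Thomassen 1987, proof of Thm 4.1, steps (1)–(4) in the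
digraph language):

* `isStrong_of_deletionMinimal` — `D(G, M)` is strongly connected (otherwise `G` splits along a
  set of vertices closed under out-arcs into two proper subgraphs whose Pólya signings glue);
* `exists_ear_structure_degrees` — for a removable arc `u → v` (deletion keeps `D` strong) with ear
  structure `A, B, S`: every arc leaving `v` is `v → A v` or `v → B v`, every arc entering `u`
  comes from `A⁻¹ u` or `B⁻¹ u`, every arc leaving `u` other than `u → v` and every arc entering
  `v` other than `u → v` lies on `S`;
* `isStrong_erase_of_isArc_head` — **removability propagates**: if `u → v` is removable and all
  out-degrees are `≥ 2`, then both arcs leaving `v` are removable;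
* `isStrong_erase_of_exists` — hence (strong connectivity) if one arc is removable, EVERY arc is;
* `outNeighbours_le_two`, `inNeighbours_le_two` — and then every vertex has at most two out- and
  at most two in-neighbours (Seymour–Thomassen's step (4): `D` is 2-diregular).

## References

* C. H. C. Little, *A characterization of convertible (0,1)-matrices*, J. Combin. Theory Ser. B
  18 (1975) 187–208, §4. [Little1975]
* P. D. Seymour, C. Thomassen, *Characterization of even directed graphs*, J. Combin. Theory
  Ser. B 42 (1987) 36–45, §4 (1)–(4). [SeymourThomassen1987]
* N. Robertson, P. D. Seymour, R. Thomas, *Permanents, Pfaffian orientations, and even directed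
  circuits*, Ann. of Math. 150 (1999) 929–975, §7. [RobertsonSeymourThomas1999]
-/

namespace Literature.Combinatorics.SimpleGraph

open Equiv Finset

variable {n : ℕ} {G : Finset (Fin n × Fin n)}

/-! ### Strong connectivity from deletion-minimality -/

/-- Along a permutation inside `G`, a set of vertices closed under out-arcs is invariant.
[folklore] -/
theorem apply_mem_of_closed {W : Finset (Fin n)} (hW : ∀ a b, a ∈ W → IsArc G a b → b ∈ W)
    {γ : Perm (Fin n)} (hγ : ∀ i, (i, γ i) ∈ G) {a : Fin n} (ha : a ∈ W) : γ a ∈ W := by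
  by_cases h : γ a = a
  · rw [h]; exact ha
  · exact hW a _ ha ⟨Ne.symm h, hγ a⟩

/-- Along a permutation inside `G`, the orbit of a vertex of a set closed under out-arcs stays
in that set. [folklore] -/
theorem pow_apply_mem_of_closed {W : Finset (Fin n)} (hW : ∀ a b, a ∈ W → IsArc G a b → b ∈ W)
    {γ : Perm (Fin n)} (hγ : ∀ i, (i, γ i) ∈ G) {a : Fin n} (ha : a ∈ W) (k : ℕ) :
    (γ ^ k) a ∈ W := by
  induction k with
  | zero => simpa using ha
  | succ k ih =>
    rw [pow_succ', Perm.mul_apply]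
    exact apply_mem_of_closed hW hγ ih

/-- A cyclic permutation inside `G` meeting a set closed under out-arcs has its whole support in
that set. [folklore] -/
theorem support_subset_of_closed {W : Finset (Fin n)} (hW : ∀ a b, a ∈ W → IsArc G a b → b ∈ W)
    {γ : Perm (Fin n)} (hγc : γ.IsCycle) (hγ : ∀ i, (i, γ i) ∈ G) {a : Fin n} (ha : a ∈ W)
    (haγ : γ a ≠ a) {b : Fin n} (hb : γ b ≠ b) : b ∈ W := by
  obtain ⟨k, rfl⟩ := hγc.exists_pow_eq haγ hb
  exact pow_apply_mem_of_closed hW hγ ha k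

/-- **`D(G, M)` of a deletion-minimal non-Pfaffian `G ⊇ diagonal` is strongly connected**
(provided every vertex has an out-arc). Otherwise let `W ∌ y` be the set of vertices reachable
from some `x`; the subgraphs "diagonal ∪ arcs inside `W`" and "diagonal ∪ arcs outside `W`" are
proper (an arc leaves `y ∉ W`, an arc leaves `x ∈ W`), hence Pfaffian, and since every directed
circuit lies inside `W` or outside `W`, their normalised Pólya signings glue to one of `G`
(Little 1975, §4: "we may assume `G_f` strongly connected"; Seymour–Thomassen 1987, (1)).
[cite: Little1975, §4] -/
theorem isStrong_of_deletionMinimal (hdiag : ∀ i, (i, i) ∈ G) (hG : ¬ IsPfaffianBipartite G)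
    (hdel : ∀ e ∈ G, IsPfaffianBipartite (G.erase e)) (hout : ∀ x : Fin n, ∃ y, IsArc G x y) :
    IsStrong G := by
  classical
  by_contra hns
  obtain ⟨x, y, hxy⟩ : ∃ x y, ¬ Relation.ReflTransGen (IsArc G) x y := by
    by_contra h
    exact hns fun x y => not_not.1 fun hxy => h ⟨x, y, hxy⟩
  set W : Finset (Fin n) := Finset.univ.filter fun w => Relation.ReflTransGen (IsArc G) x w
    with hWdef
  have hWmem : ∀ w, w ∈ W ↔ Relation.ReflTransGen (IsArc G) x w := fun w => by simp [hWdef]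
  have hxW : x ∈ W := (hWmem x).2 Relation.ReflTransGen.refl
  have hyW : y ∉ W := fun h => hxy ((hWmem y).1 h)
  have hWcl : ∀ a b, a ∈ W → IsArc G a b → b ∈ W := fun a b ha hab =>
    (hWmem b).2 (((hWmem a).1 ha).tail hab)
  -- the two pieces
  set G₁ : Finset (Fin n × Fin n) := G.filter fun e => e.1 = e.2 ∨ (e.1 ∈ W ∧ e.2 ∈ W) with hG₁
  set G₂ : Finset (Fin n × Fin n) := G.filter fun e => e.1 = e.2 ∨ (e.1 ∉ W ∧ e.2 ∉ W) with hG₂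
  have hdiag₁ : ∀ i, (i, i) ∈ G₁ := fun i => Finset.mem_filter.2 ⟨hdiag i, Or.inl rfl⟩
  have hdiag₂ : ∀ i, (i, i) ∈ G₂ := fun i => Finset.mem_filter.2 ⟨hdiag i, Or.inl rfl⟩
  have hP₁ : IsPfaffianBipartite G₁ := by
    obtain ⟨b, hyb⟩ := hout y
    refine (hdel (y, b) hyb.2).anti fun e he => Finset.mem_erase.2 ⟨?_, (Finset.mem_filter.1 he).1⟩
    rintro rfl
    rcases (Finset.mem_filter.1 he).2 with h | h
    · exact hyb.1 h
    · exact hyW h.1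
  have hP₂ : IsPfaffianBipartite G₂ := by
    obtain ⟨b, hxb⟩ := hout x
    refine (hdel (x, b) hxb.2).anti fun e he => Finset.mem_erase.2 ⟨?_, (Finset.mem_filter.1 he).1⟩
    rintro rfl
    rcases (Finset.mem_filter.1 he).2 with h | h
    · exact hxb.1 h
    · exact h.1 hxW
  obtain ⟨s₁, h1₁, hpos₁⟩ := (isPfaffianBipartite_iff_forall_isCycle hdiag₁).1 hP₁
  obtain ⟨s₂, h1₂, hpos₂⟩ := (isPfaffianBipartite_iff_forall_isCycle hdiag₂).1 hP₂
  -- glue the signings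
  apply hG
  rw [isPfaffianBipartite_iff_forall_isCycle hdiag]
  refine ⟨fun e => if e.1 ∈ W then s₁ e else s₂ e, fun i => ?_, fun γ hγc hγ => ?_⟩
  · by_cases hi : i ∈ W
    · simp only [hi, if_true, h1₁]
    · simp only [hi, if_false, h1₂]
  by_cases hcase : ∃ a, γ a ≠ a ∧ a ∈ W
  · -- the circuit lies inside `W`
    obtain ⟨a, haγ, ha⟩ := hcase
    have hsupp : ∀ b, γ b ≠ b → b ∈ W := fun b hb => support_subset_of_closed hWcl hγc hγ ha haγ hb
    have hin : ∀ i, (i, γ i) ∈ G₁ := by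
      intro i
      by_cases hi : γ i = i
      · rw [hi]; exact hdiag₁ i
      · exact Finset.mem_filter.2 ⟨hγ i, Or.inr ⟨hsupp i hi, apply_mem_of_closed hWcl hγ (hsupp i hi)⟩⟩
    have hprod : (∏ i, (fun e : Fin n × Fin n => if e.1 ∈ W then s₁ e else s₂ e) (i, γ i)) =
        ∏ i, s₁ (i, γ i) := by
      refine Finset.prod_congr rfl fun i _ => ?_
      by_cases hi : i ∈ W
      · simp only [hi, if_true]
      · have hfix : γ i = i := not_not.1 fun h => hi (hsupp i h)
        simp only [hi, if_false, hfix, h1₁, h1₂]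
    rw [hprod]
    exact hpos₁ γ hγc hin
  · -- the circuit lies outside `W`
    have hsupp : ∀ b, γ b ≠ b → b ∉ W := fun b hb hbW => hcase ⟨b, hb, hbW⟩
    have hin : ∀ i, (i, γ i) ∈ G₂ := by
      intro i
      by_cases hi : γ i = i
      · rw [hi]; exact hdiag₂ i
      · refine Finset.mem_filter.2 ⟨hγ i, Or.inr ⟨hsupp i hi, fun hW => hsupp i hi ?_⟩⟩
        -- if `γ i ∈ W` then, going once around the circuit, `i ∈ W`
        have hγi : γ (γ i) ≠ γ i := fun h => hi (γ.injective h)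
        exact support_subset_of_closed hWcl hγc hγ hW hγi hi
    have hprod : (∏ i, (fun e : Fin n × Fin n => if e.1 ∈ W then s₁ e else s₂ e) (i, γ i)) =
        ∏ i, s₂ (i, γ i) := by
      refine Finset.prod_congr rfl fun i _ => ?_
      by_cases hi : i ∈ W
      · have hfix : γ i = i := not_not.1 fun h => hsupp i h hi
        simp only [hi, if_true, hfix, h1₁, h1₂]
      · simp only [hi, if_false]
    rw [hprod]
    exact hpos₂ γ hγc hin

/-! ### Reachability along a circuit and along the path `S` -/

/-- Along a directed circuit `X` of `D(G, M)` starting at `v`, avoiding an arc `v → c` with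
`c ≠ X v`: every `X^k v` is reachable from `v` in `D − (v → c)`. [folklore] -/
theorem reflTransGen_pow_apply {X : Perm (Fin n)} (hXmem : ∀ i, (i, X i) ∈ G) {v c : Fin n}
    (hc : X v ≠ c) (k : ℕ) :
    Relation.ReflTransGen (IsArc (G.erase (v, c))) v ((X ^ k) v) := by
  induction k with
  | zero => exact Relation.ReflTransGen.refl
  | succ k ih =>
    rw [pow_succ', Perm.mul_apply]
    by_cases hfix : X ((X ^ k) v) = (X ^ k) v
    · rw [hfix]; exact ih
    · refine ih.tail (isArc_erase_iff.2 ⟨⟨Ne.symm hfix, hXmem _⟩, fun h => ?_⟩)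
      obtain ⟨h1, h2⟩ := Prod.ext_iff.1 h
      simp only at h1 h2
      rw [h1] at h2
      exact hc h2

/-- Every vertex moved by a directed circuit through `v` is reachable from `v` along it.
[folklore] -/
theorem reflTransGen_of_apply_ne {X : Perm (Fin n)} (hX : X.IsCycle) (hXmem : ∀ i, (i, X i) ∈ G)
    {v c b : Fin n} (hv : X v ≠ v) (hc : X v ≠ c) (hb : X b ≠ b) :
    Relation.ReflTransGen (IsArc (G.erase (v, c))) v b := by
  obtain ⟨k, rfl⟩ := hX.exists_pow_eq hv hb
  exact reflTransGen_pow_apply hXmem hc k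

/-- The path `S = u :: lS` (no repeated vertex, ending at `v`) avoids every arc leaving `v`;
hence each of its vertices is reachable from `u` in `D − (v → c)`. [folklore] -/
theorem reflTransGen_of_mem_path {u v c : Fin n} {lS : List (Fin n)}
    (hchain : (u :: lS).IsChain (IsArc G)) (hnd : (u :: lS).Nodup)
    (hlast : (u :: lS).getLast (List.cons_ne_nil _ _) = v) {b : Fin n} (hb : b ∈ u :: lS) :
    Relation.ReflTransGen (IsArc (G.erase (v, c))) u b := by
  have hchain' : (u :: lS).IsChain (IsArc (G.erase (v, c))) := by
    refine isChain_isArc_erase hchain fun i hi heq => ?_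
    have hiv : (u :: lS)[i] = v := (Prod.ext_iff.1 heq).1
    rw [← hlast, List.getLast_eq_getElem] at hiv
    have := hnd.getElem_inj_iff.1 hiv
    simp only [List.length_cons] at this hi
    omega
  obtain ⟨m, hm, rfl⟩ := List.getElem_of_mem hb
  have h := reflTransGen_head_getElem hchain' (List.cons_ne_nil _ _) hm
  exact h

/-- Every vertex reaches `v` in `D − (v → c)`: a path to `v` without repeated vertices uses no
arc leaving `v`. [folklore] -/
theorem reflTransGen_erase_of_isStrong (hs : IsStrong G) (a v c : Fin n) :
    Relation.ReflTransGen (IsArc (G.erase (v, c))) a v := by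
  obtain ⟨l, hchain, hnd, hlast⟩ := hs.exists_path a v
  have hchain' : (a :: l).IsChain (IsArc (G.erase (v, c))) := by
    refine isChain_isArc_erase hchain fun i hi heq => ?_
    have hiv : (a :: l)[i] = v := (Prod.ext_iff.1 heq).1
    rw [← hlast, List.getLast_eq_getElem] at hiv
    have := hnd.getElem_inj_iff.1 hiv
    simp only [List.length_cons] at this hi
    omega
  exact reflTransGen_of_isChain_cons hchain' hlast

/-! ### Degrees at the ends of a removable arc, and propagation of removability -/

/-- **The ear structure with its degree consequences.** For a removable arc `u → v` of a
deletion-minimal non-Pfaffian `G ⊇ diagonal`, with `A, B, S` from `exists_ear_structure`: every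
arc leaving `v` goes to `A v` or to `B v`; every arc entering `u` comes from `A⁻¹ u` or `B⁻¹ u`;
every arc leaving `u`, other than `u → v`, and every arc entering `v`, other than `u → v`, is an
arc of `S` (Little 1975, §4; Seymour–Thomassen 1987, (4)). [cite: Little1975, §4] -/
theorem exists_ear_structure_degrees (hdiag : ∀ i, (i, i) ∈ G) (hG : ¬ IsPfaffianBipartite G)
    (hdel : ∀ e ∈ G, IsPfaffianBipartite (G.erase e)) {u v : Fin n} (huv : IsArc G u v)
    (hstrong : IsStrong (G.erase (u, v))) :
    ∃ (s : Fin n × Fin n → ℤˣ) (A B : Perm (Fin n)) (lS : List (Fin n)),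
      (∀ i, s (i, i) = 1) ∧ s (u, v) = 1 ∧
      (∀ γ : Perm (Fin n), γ.IsCycle → (∀ i, (i, γ i) ∈ G) → γ u ≠ v →
        Perm.sign γ * ∏ i, s (i, γ i) = 1) ∧
      A.IsCycle ∧ (∀ i, (i, A i) ∈ G) ∧ A u = v ∧ Perm.sign A * ∏ i, s (i, A i) = -1 ∧
      B.IsCycle ∧ (∀ i, (i, B i) ∈ G) ∧ B u = v ∧ Perm.sign B * ∏ i, s (i, B i) = 1 ∧
      (u :: lS).IsChain (IsArc (G.erase (u, v))) ∧ (u :: lS).Nodup ∧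
      (u :: lS).getLast (List.cons_ne_nil _ _) = v ∧
      (∀ a b, IsArc G a b → A a = b ∨ B a = b ∨ (a, b) ∈ (u :: lS).zip lS) ∧
      (∀ b, IsArc G v b → b = A v ∨ b = B v) ∧
      (∀ a, IsArc G a u → A a = u ∨ B a = u) ∧
      (∀ b, IsArc G u b → b = v ∨ (u, b) ∈ (u :: lS).zip lS) ∧
      (∀ a, IsArc G a v → a = u ∨ (a, v) ∈ (u :: lS).zip lS) := by
  obtain ⟨s, A, B, lS, h1, hsuv, hpos, hA, hAmem, hAu, hAw, hB, hBmem, hBu, hBw, hSchain, hSnd,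
    hSlast, hcover⟩ := exists_ear_structure hdiag hG hdel huv hstrong
  -- in `S`, `v` is only the last vertex and `u` only the first
  have hfst_ne_v : ∀ p ∈ (u :: lS).zip lS, p.1 ≠ v := by
    intro p hp hp1
    obtain ⟨i, hi, hip⟩ := List.getElem_of_mem hp
    simp only [List.length_zip] at hi
    have h1' : (u :: lS)[i]'(by simp; omega) = v := by
      rw [← hp1, ← hip, List.getElem_zip]
    rw [← hSlast, List.getLast_eq_getElem] at h1'
    have := hSnd.getElem_inj_iff.1 h1'
    simp only [List.length_cons] at this
    omega
  have hsnd_ne_u : ∀ p ∈ (u :: lS).zip lS, p.2 ≠ u := by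
    intro p hp hp2
    obtain ⟨i, hi, hip⟩ := List.getElem_of_mem hp
    simp only [List.length_zip] at hi
    have h2' : (u :: lS)[i + 1]'(by simp; omega) = u := by
      rw [← hp2, ← hip, List.getElem_zip]
      simp
    have h0 : (u :: lS)[0] = u := rfl
    have := hSnd.getElem_inj_iff.1 (h2'.trans h0.symm)
    simp at this
  refine ⟨s, A, B, lS, h1, hsuv, hpos, hA, hAmem, hAu, hAw, hB, hBmem, hBu, hBw, hSchain, hSnd,
    hSlast, hcover, fun b hvb => ?_, fun a hau => ?_, fun b hub => ?_, fun a hav => ?_⟩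
  · rcases hcover v b hvb with h | h | h
    · exact Or.inl h.symm
    · exact Or.inr h.symm
    · exact absurd rfl (hfst_ne_v _ h)
  · rcases hcover a u hau with h | h | h
    · exact Or.inl h
    · exact Or.inr h
    · exact absurd rfl (hsnd_ne_u _ h)
  · rcases hcover u b hub with h | h | h
    · exact Or.inl (h.symm.trans hAu)
    · exact Or.inl (h.symm.trans hBu)
    · exact Or.inr h
  · rcases hcover a v hav with h | h | h
    · exact Or.inl (A.injective (h.trans hAu.symm))
    · exact Or.inl (B.injective (h.trans hBu.symm))
    · exact Or.inr h

/-- **Removability propagates along the arc.** If `u → v` is removable (its deletion keeps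
`D(G, M)` strongly connected) in a deletion-minimal non-Pfaffian `G ⊇ diagonal` all of whose
vertices have two out-arcs, then every arc leaving `v` is removable. Proof: the arcs leaving `v`
are `v → A v` and `v → B v`; in `D − (v → A v)` every vertex still reaches `v` (a path to `v`
uses no arc leaving `v`), and `v` reaches every vertex `b`: one of the two arcs leaving `b` is
not an arc of `A`, hence lies on `B` (reach `b` around `B` from `v`) or on `S` (reach `u` around
`B`, then follow `S`). [cite: Little1975, §4] -/
theorem isStrong_erase_of_isArc_head (hdiag : ∀ i, (i, i) ∈ G) (hG : ¬ IsPfaffianBipartite G)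
    (hdel : ∀ e ∈ G, IsPfaffianBipartite (G.erase e)) (hs : IsStrong G)
    (hout2 : ∀ x : Fin n, ∃ y₁ y₂, y₁ ≠ y₂ ∧ IsArc G x y₁ ∧ IsArc G x y₂) {u v : Fin n}
    (huv : IsArc G u v) (hstrong : IsStrong (G.erase (u, v))) {w : Fin n} (hvw : IsArc G v w) :
    IsStrong (G.erase (v, w)) := by
  obtain ⟨s, A, B, lS, -, -, -, hA, hAmem, hAu, -, hB, hBmem, hBu, -, hSchain, hSnd, hSlast,
    hcover, houtv, -, -, -⟩ := exists_ear_structure_degrees hdiag hG hdel huv hstrong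
  have hSchainG : (u :: lS).IsChain (IsArc G) := isChain_isArc_mono hSchain (Finset.erase_subset _ _)
  have hAv : A v ≠ v := fun h => huv.1 (A.injective (hAu.trans h.symm))
  have hBv : B v ≠ v := fun h => huv.1 (B.injective (hBu.trans h.symm))
  have hAuu : A u ≠ u := fun h => huv.1 (h.symm.trans hAu)
  have hBuu : B u ≠ u := fun h => huv.1 (h.symm.trans hBu)
  -- the two arcs leaving `v` are `v → A v ≠ v → B v`
  have hAB : A v ≠ B v := by
    obtain ⟨y₁, y₂, hne, hy₁, hy₂⟩ := hout2 v
    intro hAB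
    rcases houtv y₁ hy₁ with h₁ | h₁ <;> rcases houtv y₂ hy₂ with h₂ | h₂
    · exact hne (h₁.trans h₂.symm)
    · exact hne (h₁.trans (hAB.trans h₂.symm))
    · exact hne (h₁.trans (hAB.symm.trans h₂.symm))
    · exact hne (h₁.trans h₂.symm)
  -- generic argument for `X ∈ {A, B}` playing the role of "the other circuit"
  suffices key : ∀ (X Y : Perm (Fin n)), X.IsCycle → (∀ i, (i, X i) ∈ G) → X u = v → X v ≠ v →
      Y.IsCycle → (∀ i, (i, Y i) ∈ G) → Y u = v → Y v ≠ v → X v ≠ Y v →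
      (∀ a b, IsArc G a b → X a = b ∨ Y a = b ∨ (a, b) ∈ (u :: lS).zip lS) →
      IsStrong (G.erase (v, X v)) by
    rcases houtv w hvw with rfl | rfl
    · exact key A B hA hAmem hAu hAv hB hBmem hBu hBv hAB hcover
    · refine key B A hB hBmem hBu hBv hA hAmem hAu hAv hAB.symm fun a b hab => ?_
      rcases hcover a b hab with h | h | h
      exacts [Or.inr (Or.inl h), Or.inl h, Or.inr (Or.inr h)]
  intro X Y hX hXmem hXu hXv hY hYmem hYu hYv hXY hcov a b
  -- `a` reaches `v`, and `v` reaches `b`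
  refine (reflTransGen_erase_of_isStrong hs a v (X v)).trans ?_
  have hYuu : Y u ≠ u := fun h => huv.1 (h.symm.trans hYu)
  have hreach_u : Relation.ReflTransGen (IsArc (G.erase (v, X v))) v u :=
    reflTransGen_of_apply_ne hY hYmem hYv (Ne.symm hXY) hYuu
  -- one of the two arcs leaving `b` is not the arc of `X`
  obtain ⟨y₁, y₂, hne, hy₁, hy₂⟩ := hout2 b
  obtain ⟨y, hby, hXby⟩ : ∃ y, IsArc G b y ∧ X b ≠ y := by
    by_cases h : X b = y₁
    · exact ⟨y₂, hy₂, fun h' => hne (h.symm.trans h')⟩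
    · exact ⟨y₁, hy₁, h⟩
  rcases hcov b y hby with h | h | h
  · exact absurd h hXby
  · -- `b` lies on `Y`
    have hbY : Y b ≠ b := by rw [h]; exact hby.1.symm
    exact reflTransGen_of_apply_ne hY hYmem hYv (Ne.symm hXY) hbY
  · -- `b` lies on `S`
    have hbS : b ∈ u :: lS := (List.of_mem_zip h).1
    exact hreach_u.trans (reflTransGen_of_mem_path hSchainG hSnd hSlast hbS)

/-- **If one arc is removable, every arc is.** From `isStrong_erase_of_isArc_head`, the set of
vertices all of whose out-arcs are removable contains the head of a removable arc and is closed
under out-arcs, hence (strong connectivity) is everything. [folklore] -/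
theorem isStrong_erase_of_exists (hdiag : ∀ i, (i, i) ∈ G) (hG : ¬ IsPfaffianBipartite G)
    (hdel : ∀ e ∈ G, IsPfaffianBipartite (G.erase e)) (hs : IsStrong G)
    (hout2 : ∀ x : Fin n, ∃ y₁ y₂, y₁ ≠ y₂ ∧ IsArc G x y₁ ∧ IsArc G x y₂)
    (h₀ : ∃ u v, IsArc G u v ∧ IsStrong (G.erase (u, v))) {a b : Fin n} (hab : IsArc G a b) :
    IsStrong (G.erase (a, b)) := by
  obtain ⟨u, v, huv, hrem⟩ := h₀
  -- every vertex reachable from `v` has all its out-arcs removable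
  have key : ∀ x, Relation.ReflTransGen (IsArc G) v x → ∀ w, IsArc G x w →
      IsStrong (G.erase (x, w)) := by
    intro x hx
    induction hx with
    | refl => exact fun w hvw => isStrong_erase_of_isArc_head hdiag hG hdel hs hout2 huv hrem hvw
    | tail _ hyz ih =>
      exact fun w hzw => isStrong_erase_of_isArc_head hdiag hG hdel hs hout2 hyz (ih _ hyz) hzw
  exact key a (hs v a) b hab

/-- **Every vertex has at most two out-neighbours** once every arc is removable (the ends of a
removable arc entering `x` control the arcs leaving `x`; Seymour–Thomassen 1987, (4)).
[cite: SeymourThomassen1987, §4 (4)] -/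
theorem outNeighbours_le_two (hdiag : ∀ i, (i, i) ∈ G) (hG : ¬ IsPfaffianBipartite G)
    (hdel : ∀ e ∈ G, IsPfaffianBipartite (G.erase e))
    (hrem : ∀ a b, IsArc G a b → IsStrong (G.erase (a, b))) (x : Fin n) (hin : ∃ a, IsArc G a x) :
    ∃ p q : Fin n, ∀ w, IsArc G x w → w = p ∨ w = q := by
  obtain ⟨a, hax⟩ := hin
  obtain ⟨-, A, B, -, -, -, -, -, -, -, -, -, -, -, -, -, -, -, -, houtx, -, -, -⟩ :=
    exists_ear_structure_degrees hdiag hG hdel hax (hrem a x hax)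
  exact ⟨A x, B x, houtx⟩

/-- **Every vertex has at most two in-neighbours** once every arc is removable.
[cite: SeymourThomassen1987, §4 (4)] -/
theorem inNeighbours_le_two (hdiag : ∀ i, (i, i) ∈ G) (hG : ¬ IsPfaffianBipartite G)
    (hdel : ∀ e ∈ G, IsPfaffianBipartite (G.erase e))
    (hrem : ∀ a b, IsArc G a b → IsStrong (G.erase (a, b))) (x : Fin n) (hout : ∃ b, IsArc G x b) :
    ∃ p q : Fin n, ∀ a, IsArc G a x → a = p ∨ a = q := by
  obtain ⟨b, hxb⟩ := hout
  obtain ⟨-, A, B, -, -, -, -, -, -, -, -, -, -, -, -, -, -, -, -, -, hinx, -, -⟩ :=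
    exists_ear_structure_degrees hdiag hG hdel hxb (hrem x b hxb)
  refine ⟨A.symm x, B.symm x, fun a hax => ?_⟩
  rcases hinx a hax with h | h
  · exact Or.inl (by rw [← h]; simp)
  · exact Or.inr (by rw [← h]; simp)

end Literature.Combinatorics.SimpleGraph
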